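import Literature.Barriers.QuantumAdvantage.PBlockedSimBits
import Literature.Computability.Complexity.CodeFPLists
import Literature.Computability.Complexity.CodeFPFinite
import Literature.Computability.Complexity.CodeFPBudgets
import HarnessLib

/-!
# The `p`-blocked simulator in typed polynomial time, I: bit lists

Topic `Literature/Barriers/QuantumAdvantage`; first file of the *polynomial-time certificate* of the
functional program `PSim` (`PBlockedSim.lean`), the classical machine of Jozsa–Linden's lemma
`ratpbl` / theorem `pblthm` (Proc. R. Soc. A 459 (2003), §3: "a classical simulation … using a number
of rational arithmetic operations that grows linearly with `j` … [hence] `poly(j)` elementary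
computational steps"). The certificate is written in the typed `FP` algebra `CodeFP`
(`Complexity/CodeFP.lean`: `CodeFP eα eβ g` = the mathematical map `g` is computed on codes by a
polynomial-time string function), combinator by combinator along the program text, so that no
machine is written. This file treats the bit-list layer (configurations and masks are `N`-bit lists
coded item by item, `cfgE = rawE bitE`):

* `cfgE`, `cfgE_injective`, `length_cfgE` (`= 4·|u|`);
* `band_fp`, `bor_fp`, `bandnot_fp`, `pw_fp` (`zipWith`), `zeros_fp` (from a unary `N`), `oneHot_fp`,
  `getD_fp`, `popcount_fp` / `popcountUn_fp` (binary / unary bit count);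
* **`deposit_fp`** — `deposit k m` as a left fold over the mask (`deposit_eq_foldl`) with the state
  `(k', bits so far)` bounded by the input (`CodeFP.foldl`);
* **`subCfgs_fp`** — the enumeration of the configurations supported in a mask, for a fixed block
  bound `p` (the count `min (2^{popcount m}) (4^p)` through `natPow`/`natMin`, the range through the
  unary budget `4^p`, then `deposit`);
* `setAt_fp`, `setLocal_fp` (positional writes by `take`/`drop` with unary counts).

## References

* R. Jozsa, N. Linden, *On the role of entanglement in quantum-computational speed-up*, Proc. R. Soc.
  Lond. A 459 (2003) 2011–2032, arXiv:quant-ph/0201143: §3, lemma `ratlemma`, proof of lemma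
  `ratpbl` ("poly(j) elementary computational steps"), theorem `pblthm`.
* S. Arora, B. Barak, *Computational Complexity: A Modern Approach*, CUP 2009, §1.3 (polynomial time
  is closed under composition and polynomially bounded loops).
-/

noncomputable section

namespace Literature.Barriers.QuantumAdvantage

namespace PSim

open _root_.Computability Polynomial Literature.Computability.Complexity Literature.Computability.Complexity.CodeFP
  Literature.Computability.QuantumComplexity

/-! ### The code of a bit list -/

/-- The code of a configuration / mask: the raw list of its bits. [folklore] -/
abbrev cfgE : Cfg → List Bool := rawE bitE

/-- `cfgE` is injective. [folklore] -/
theorem cfgE_injective : Function.Injective cfgE := rawE_injective bitE_injective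

/-- `|cfgE u| = 4|u|`. [folklore] -/
theorem length_cfgE (u : Cfg) : (cfgE u).length = 4 * u.length := by
  rw [cfgE, length_rawE]
  induction u with
  | nil => simp
  | cons b u ih =>
    rw [List.map_cons, List.sum_cons, ih, List.length_cons]
    simp [bitE]
    ring

/-! ### Bitwise operations -/

/-- `band` on codes. [folklore] -/
theorem band_fp : CodeFP (pairE cfgE cfgE) cfgE (fun p => band p.1 p.2) := by
  have hg : CodeFP (pairE unitE (pairE bitE bitE)) bitE (fun t => t.2.1 && t.2.2) :=
    CodeFP.and (snd _ _).fst' (snd _ _).snd'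
  exact ((zipWith hg).comp ((const _ ()).pair (CodeFP.id _))).congr fun p => rfl

/-- `bor` on codes. [folklore] -/
theorem bor_fp : CodeFP (pairE cfgE cfgE) cfgE (fun p => bor p.1 p.2) := by
  have hg : CodeFP (pairE unitE (pairE bitE bitE)) bitE (fun t => t.2.1 || t.2.2) :=
    CodeFP.or (snd _ _).fst' (snd _ _).snd'
  exact ((zipWith hg).comp ((const _ ()).pair (CodeFP.id _))).congr fun p => rfl

/-- `bandnot` on codes. [folklore] -/
theorem bandnot_fp : CodeFP (pairE cfgE cfgE) cfgE (fun p => bandnot p.1 p.2) := by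
  have hg : CodeFP (pairE unitE (pairE bitE bitE)) bitE (fun t => t.2.1 && !t.2.2) :=
    CodeFP.and (snd _ _).fst' (CodeFP.not (snd _ _).snd')
  exact ((zipWith hg).comp ((const _ ()).pair (CodeFP.id _))).congr fun p => rfl

/-- **`pw` (gluing along a mask) on codes.** [folklore] -/
theorem pw_fp : CodeFP (pairE cfgE (pairE cfgE cfgE)) cfgE (fun t => pw t.1 t.2.1 t.2.2) :=
  (bor_fp.comp ((band_fp.comp ((snd _ _).fst'.pair (fst _ _))).pair
    (bandnot_fp.comp ((snd _ _).snd'.pair (fst _ _))))).congr fun _ => rfl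

/-- `zeros` from a unary length. [folklore] -/
theorem zeros_fp : CodeFP unE cfgE zeros :=
  ((replicateOf bitE).comp ((const unE false).pair (CodeFP.id unE))).congr fun _ => rfl

/-- `oneHot` from a unary length and a binary position. [folklore] -/
theorem oneHot_fp : CodeFP (pairE unE natE) cfgE (fun p => oneHot p.1 p.2) := by
  have hg : CodeFP (pairE natE natE) bitE (fun q => decide (q.2 = q.1)) := natEq.comp ((snd _ _).pair (fst _ _))
  exact ((map hg).comp ((snd _ _).pair (urange.comp (fst _ _)))).congr fun p => rfl

/-- Reading a bit at a binary position (`false` past the end). [folklore] -/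
theorem getD_fp : CodeFP (pairE cfgE natE) bitE (fun p => p.1.getD p.2 false) :=
  (rawGetOr bitE).comp ((fst _ _).pair ((snd _ _).pair (const _ false)))

/-- The bit count as the length of a filter. [folklore] -/
theorem popcount_eq_length_filter (m : Cfg) : popcount m = (m.filter fun b => b).length := by
  rw [popcount, List.count_eq_countP, List.countP_eq_length_filter]
  congr 1
  exact List.filter_congr fun b _ => by cases b <;> rfl

/-- The bit count, in unary. [folklore] -/
theorem popcountUn_fp : CodeFP cfgE unE popcount := by
  have hp : CodeFP (pairE unitE bitE) bitE (fun q => q.2) := snd _ _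
  exact ((ulength bitE).comp ((CodeFP.filter hp).comp ((const _ ()).pair (CodeFP.id _)))).congr fun m => by
    rw [popcount_eq_length_filter]
    rfl

/-- The bit count, in binary. [folklore] -/
theorem popcount_fp : CodeFP cfgE natE popcount := (natOfUn.comp popcountUn_fp).congr fun _ => rfl

/-! ### The enumeration `deposit` / `subCfgs` -/

/-- One step of `deposit` as a left fold: consume a mask bit, emit a configuration bit. [folklore] -/
def depositStep (b : Bool) (st : ℕ × Cfg) : ℕ × Cfg :=
  if b then (st.1 / 2, st.2 ++ [decide (st.1 % 2 = 1)]) else (st.1, st.2 ++ [false])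

/-- The fold of `depositStep` appends `deposit`. [folklore] -/
theorem foldl_depositStep : ∀ (m : Cfg) (k : ℕ) (acc : Cfg),
    (m.foldl (fun st b => depositStep b st) (k, acc)).2 = acc ++ deposit k m
  | [], k, acc => by simp [deposit]
  | false :: m, k, acc => by
    rw [List.foldl_cons, show depositStep false (k, acc) = (k, acc ++ [false]) by simp [depositStep],
      foldl_depositStep m k, List.append_assoc]
    rfl
  | true :: m, k, acc => by
    rw [List.foldl_cons,
      show depositStep true (k, acc) = (k / 2, acc ++ [decide (k % 2 = 1)]) by simp [depositStep],
      foldl_depositStep m (k / 2), List.append_assoc]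
    rfl

/-- **`deposit` is a left fold over the mask.** [folklore] -/
theorem deposit_eq_foldl (k : ℕ) (m : Cfg) : deposit k m = (m.foldl (fun st b => depositStep b st) (k, [])).2 := by
  rw [foldl_depositStep, List.nil_append]

/-- The counter of the fold only decreases. [folklore] -/
theorem foldl_depositStep_fst_le : ∀ (m : Cfg) (k : ℕ) (acc : Cfg),
    (m.foldl (fun st b => depositStep b st) (k, acc)).1 ≤ k
  | [], k, acc => le_rfl
  | b :: m, k, acc => by
    rw [List.foldl_cons]
    cases b
    · rw [show depositStep false (k, acc) = (k, acc ++ [false]) by simp [depositStep]]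
      exact foldl_depositStep_fst_le m k _
    · rw [show depositStep true (k, acc) = (k / 2, acc ++ [decide (k % 2 = 1)]) by simp [depositStep]]
      exact (foldl_depositStep_fst_le m (k / 2) _).trans (Nat.div_le_self k 2)

/-- The emitted list of the fold grows by one bit per mask bit. [folklore] -/
theorem length_foldl_depositStep_snd (m : Cfg) (k : ℕ) (acc : Cfg) :
    (m.foldl (fun st b => depositStep b st) (k, acc)).2.length = acc.length + m.length := by
  rw [foldl_depositStep, List.length_append, length_deposit]

/-- **`deposit` on codes.** [cite: AroraBarak2009, §1.3 (bounded loops)] -/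
theorem deposit_fp : CodeFP (pairE natE cfgE) cfgE (fun p => deposit p.1 p.2) := by
  -- the step on `(k, (b, (k', acc)))`
  have hb : CodeFP (pairE natE (pairE bitE (pairE natE cfgE))) bitE (fun t => t.2.1) := (snd _ _).fst'
  have hk : CodeFP (pairE natE (pairE bitE (pairE natE cfgE))) natE (fun t => t.2.2.1) := (snd _ _).snd'.fst'
  have hacc : CodeFP (pairE natE (pairE bitE (pairE natE cfgE))) cfgE (fun t => t.2.2.2) := (snd _ _).snd'.snd'
  have hbit : CodeFP (pairE natE (pairE bitE (pairE natE cfgE))) bitE (fun t => decide (t.2.2.1 % 2 = 1)) :=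
    natEq.comp ((natMod.comp (hk.pair (const _ 2))).pair (const _ 1))
  have hthen : CodeFP (pairE natE (pairE bitE (pairE natE cfgE))) (pairE natE cfgE)
      (fun t => (t.2.2.1 / 2, t.2.2.2 ++ [decide (t.2.2.1 % 2 = 1)])) :=
    (natDiv.comp (hk.pair (const _ 2))).pair ((rawAppend bitE).comp (hacc.pair ((rawSingleton bitE).comp hbit)))
  have helse : CodeFP (pairE natE (pairE bitE (pairE natE cfgE))) (pairE natE cfgE)
      (fun t => (t.2.2.1, t.2.2.2 ++ [false])) :=
    hk.pair ((rawAppend bitE).comp (hacc.pair (const _ [false])))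
  have hstep : CodeFP (pairE natE (pairE bitE (pairE natE cfgE))) (pairE natE cfgE)
      (fun t => depositStep t.2.1 t.2.2) :=
    (hb.ite hthen helse).congr fun t => by
      unfold depositStep
      cases t.2.1 <;> rfl
  have hinit : CodeFP natE (pairE natE cfgE) (fun k => (k, ([] : Cfg))) := (CodeFP.id natE).pair (const natE [])
  have h := foldl (σ := ℕ) (α := Bool) (β := ℕ × Cfg) (eσ := natE) (eα := bitE) (eβ := pairE natE cfgE)
    (step := fun _ b st => depositStep b st) (init := fun k => (k, [])) hstep hinit (X + 2) (fun k l₁ l₂ => by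
      simp only [pairE_apply, length_boolPair, eval_add, eval_X, eval_ofNat]
      have h1 : (natE (l₁.foldl (fun st b => depositStep b st) (k, [])).1).length ≤ (natE k).length := by
        rw [length_natE, length_natE]
        exact size_mono (foldl_depositStep_fst_le l₁ k [])
      have h2 : (cfgE (l₁.foldl (fun st b => depositStep b st) (k, [])).2).length ≤ (rawE bitE (l₁ ++ l₂)).length := by
        rw [length_cfgE, length_foldl_depositStep_snd, List.length_nil, zero_add, ← length_cfgE]
        exact length_rawE_le_of_sublist bitE (List.sublist_append_left l₁ l₂)
      omega)
  exact h.snd'.congr fun p => by rw [deposit_eq_foldl]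

/-- The count of the enumeration through the cap: `min (2^{popcount m}) (4^p) ≤ 4^p`. [folklore] -/
theorem min_pow_le (p : ℕ) (m : Cfg) : min (2 ^ popcount m) (4 ^ p) ≤ 4 ^ p := min_le_right _ _

/-- **The enumeration `subCfgs p` on codes**, for a fixed block bound `p`.
[cite: JozsaLinden2003, §3 (proof of lemma ratpbl, (b): "at most 2^{p+1} real numbers since each block has size at most p")] -/
theorem subCfgs_fp (p : ℕ) : CodeFP cfgE (rawE cfgE) (subCfgs p) := by
  have hcount : CodeFP cfgE natE (fun m => min (2 ^ popcount m) (4 ^ p)) :=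
    natMin.comp ((natPow.comp ((const _ 2).pair popcountUn_fp)).pair (const _ (4 ^ p)))
  have hrange : CodeFP cfgE (rawE natE) (fun m => List.range (min (2 ^ popcount m) (4 ^ p))) :=
    (rangeOf.comp ((const cfgE (4 ^ p)).pair hcount)).congr fun m => by
      simp only
      rw [min_eq_left (min_pow_le p m)]
  have hmap := map (σ := Cfg) (eσ := cfgE) (eα := natE) (g := fun q => deposit q.2 q.1)
    (deposit_fp.comp ((snd _ _).pair (fst _ _)))
  exact (hmap.comp ((CodeFP.id cfgE).pair hrange)).congr fun m => rfl

/-! ### Positional writes -/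

/-- `take`/`drop` by a binary index, clamped. [folklore] -/
theorem take_min_length {α : Type} (l : List α) (i : ℕ) : l.take (min i l.length) = l.take i := by
  by_cases h : i ≤ l.length
  · rw [min_eq_left h]
  · rw [min_eq_right (not_le.1 h).le, List.take_length, List.take_of_length_le (not_le.1 h).le]

/-- `take`/`drop` by a binary index, clamped. [folklore] -/
theorem drop_min_length {α : Type} (l : List α) (i : ℕ) : l.drop (min i l.length) = l.drop i := by
  by_cases h : i ≤ l.length
  · rw [min_eq_left h]
  · rw [min_eq_right (not_le.1 h).le, List.drop_length, List.drop_of_length_le (not_le.1 h).le]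

/-- **`setAt` on codes** (the program's `take`/`drop` form, defined on every index). [folklore] -/
theorem setAt_fp : CodeFP (pairE cfgE (pairE natE bitE)) cfgE (fun t => setAt t.1 t.2.1 t.2.2) := by
  have hu : CodeFP (pairE cfgE (pairE natE bitE)) cfgE (fun t => t.1) := fst _ _
  have hi : CodeFP (pairE cfgE (pairE natE bitE)) natE (fun t => t.2.1) := (snd _ _).fst'
  have ha : CodeFP (pairE cfgE (pairE natE bitE)) bitE (fun t => t.2.2) := (snd _ _).snd'
  have hn : CodeFP (pairE cfgE (pairE natE bitE)) unE (fun t => min t.2.1 t.1.length) :=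
    unOfNatMin.comp (((ulength bitE).comp hu).pair hi)
  have hn1 : CodeFP (pairE cfgE (pairE natE bitE)) unE (fun t => min (t.2.1 + 1) t.1.length) :=
    unOfNatMin.comp (((ulength bitE).comp hu).pair (natAdd.comp (hi.pair (const _ 1))))
  have h : CodeFP (pairE cfgE (pairE natE bitE)) cfgE
      (fun t => (t.1.take (min t.2.1 t.1.length) ++ [t.2.2]) ++ t.1.drop (min (t.2.1 + 1) t.1.length)) :=
    (rawAppend bitE).comp (((rawAppend bitE).comp (((rawTakeUn bitE).comp (hn.pair hu)).pair
      ((rawSingleton bitE).comp ha))).pair ((rawDropUn bitE).comp (hn1.pair hu)))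
  exact h.congr fun t => by
    simp only [setAt]
    rw [take_min_length, drop_min_length]

/-- **`setLocal` on codes** (gate triple in the first component). [folklore] -/
theorem setLocal_fp : CodeFP (pairE (pairE natE (pairE natE natE)) (pairE cfgE (pairE bitE bitE))) cfgE
    (fun t => setLocal t.1.1 t.1.2.1 t.1.2.2 t.2.1 t.2.2) := by
  have hop : CodeFP (pairE (pairE natE (pairE natE natE)) (pairE cfgE (pairE bitE bitE))) natE (fun t => t.1.1) :=
    (fst _ _).fst'
  have hi : CodeFP (pairE (pairE natE (pairE natE natE)) (pairE cfgE (pairE bitE bitE))) natE (fun t => t.1.2.1) :=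
    (fst _ _).snd'.fst'
  have hj : CodeFP (pairE (pairE natE (pairE natE natE)) (pairE cfgE (pairE bitE bitE))) natE (fun t => t.1.2.2) :=
    (fst _ _).snd'.snd'
  have hu : CodeFP (pairE (pairE natE (pairE natE natE)) (pairE cfgE (pairE bitE bitE))) cfgE (fun t => t.2.1) :=
    (snd _ _).fst'
  have ha : CodeFP (pairE (pairE natE (pairE natE natE)) (pairE cfgE (pairE bitE bitE))) bitE (fun t => t.2.2.1) :=
    (snd _ _).snd'.fst'
  have hb : CodeFP (pairE (pairE natE (pairE natE natE)) (pairE cfgE (pairE bitE bitE))) bitE (fun t => t.2.2.2) :=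
    (snd _ _).snd'.snd'
  have h1 : CodeFP (pairE (pairE natE (pairE natE natE)) (pairE cfgE (pairE bitE bitE))) cfgE
      (fun t => setAt t.2.1 t.1.2.1 t.2.2.1) := setAt_fp.comp (hu.pair (hi.pair ha))
  have h2 : CodeFP (pairE (pairE natE (pairE natE natE)) (pairE cfgE (pairE bitE bitE))) cfgE
      (fun t => setAt (setAt t.2.1 t.1.2.1 t.2.2.1) t.1.2.2 t.2.2.2) := setAt_fp.comp (h1.pair (hj.pair hb))
  have htest : CodeFP (pairE (pairE natE (pairE natE natE)) (pairE cfgE (pairE bitE bitE))) bitE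
      (fun t => decide (t.1.1 = 3)) := natEq.comp (hop.pair (const _ 3))
  exact (htest.ite h2 h1).congr fun t => by
    simp only [setLocal]
    by_cases h : t.1.1 = 3 <;> simp [h]

end PSim

end Literature.Barriers.QuantumAdvantage

end
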